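import Summits.NavierStokesRegularity.NavierStokesRegularity.Theses.SymmetryModuliCount
import Summits.NavierStokesRegularity.NavierStokesRegularity.Theorems.SymmetryModuliCountHelicalEndLiouvilleScrewPeriod
import Summits.NavierStokesRegularity.NavierStokesRegularity.Theorems.SymmetryModuliCountHelicalEndLiouvilleCellGaps
import Summits.NavierStokesRegularity.NavierStokesRegularity.Theorems.SymmetryModuliCountHelicalEndLiouvilleCellOscRepr
import Summits.NavierStokesRegularity.NavierStokesRegularity.Theorems.SymmetryModuliCountHelicalEndLiouvilleCellOscSlice
import Summits.NavierStokesRegularity.NavierStokesRegularity.Theorems.SymmetryModuliCountHelicalEndLiouvilleCellAbsorption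
import Summits.NavierStokesRegularity.NavierStokesRegularity.Theorems.SymmetryModuliCountHelicalEndLiouvilleLineLiouvilleEnd
import Summits.NavierStokesRegularity.NavierStokesRegularity.Theorems.SymmetryModuliCountHelicalEndLiouvilleForwardVanishing
import HarnessLib

/-!
# Route SymmetryModuliCount — crux `HelicalEndLiouville` (stmt-NavierStokesRegularity-14062), proved

**Theorem.** A Type-I ancient mild Navier–Stokes field `u ∈ A_C` (`IsTypeIAncientMild C u`:
jointly smooth on `t < 0`, divergence-free, Oseen/KNSS integral equation between every pair of
times, `‖u(t)‖_∞ ≤ C/√(−t)`) that is annihilated on a backward end `t < θ ≤ 0` by a Killing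
generator `(a + Ax)·∇ − A` with `A` skew and `a ∉ range A` — a translation (`A = 0`, `a ≠ 0`) or
a screw motion of NONZERO pitch — vanishes on that end.

This file is the sorry-free composition of the line `vanishing-cell-reynolds` (idea card
`Cruxes/HelicalEndLiouville/Ideas/vanishing-cell-reynolds.md`; checked skeleton
`Cruxes/HelicalEndLiouville/Lines/vanishing-cell-reynolds.lean`), whose seven stubs are the
sibling files `SymmetryModuliCountHelicalEndLiouville*.lean`:

1. `stub_helicalScrewPeriod` — screw ⊃ lattice: the symmetry makes every slice `L`-periodic for
   one `L ≠ 0` (`L = a` if `A = 0`, else one full turn of the screw: `A³ = −ρ²A`, Rodrigues).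
2. `stub_cellGaps` — Poincaré gap of the period cell in sup norm (Wirtinger) for the heat flow and
   for one Oseen slice: oscillations `≤ κ‖L‖²σ⁻¹M`, `≤ κ min(σ^{-1/2}, ‖L‖²σ^{-3/2}) M_f M_g`.
3. `stub_cellOscRepr` — the cell oscillation `u − Π₀u` through the Oseen identity from time `s`.
4. `stub_cellOscSlice` — the mean cannot force the oscillation: the oscillation of `N_σ[f,f]` is
   linear in `‖(I − Π₀)f‖_∞`.
5. `stub_cellAbsorption` — absorption on a far end (kernel mass `4‖L‖` against the Type-I
   coefficient `C/√(−t)`: vanishing cell Reynolds number `C‖L‖/√(−t)`): the oscillation is extinct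
   on `t < min θ (−(8KC‖L‖)²)` and `u` is invariant under ALL translations along `L` there.
6. `stub_lineLiouvilleEnd` — the 2.5-D leaf: the PROVED tree theorem
   `KNSS2009_typeI_rate_liouville_holds` (KNSS 2009, proof of Thm 6.2 with Thm 5.1) after a
   rotation (rotation covariance of `A_C`) and a time shift.
7. `stub_forwardVanishing` — vanishing on a backward end propagates forward (route support item
   `BackwardEndVanishing`, stmt-14064; `oseenMild_bounded_unique`).

No compactness, no blow-down, no Kato gap; every analytic input is a proved tree theorem.

## References

* G. Koch, N. Nadirashvili, G. Seregin, V. Šverák, Acta Math. 203 (2009) = arXiv:0709.3599,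
  Thm 5.1, §4, proof of Thm 6.2. [KochNadirashviliSereginSverak2009]
* Z. Lei, X. Ren, Q. S. Zhang, arXiv:1902.11229 (periodic axisymmetric case, nearest print).
* G. Raugel, G. Sell, J. Amer. Math. Soc. 6 (1993) (thin-domain damping of `(I − M)u`);
  T. Gallay, S. Slijepčević, arXiv:1402.6563 (the cell Reynolds number).
-/

noncomputable section

-- the summit and its single sub-problem share the name (CONVENTIONS §1), as in every Theorems file
set_option linter.dupNamespace false

open Literature.Analysis.FluidPDE

namespace Summit.NavierStokesRegularity.NavierStokesRegularity.Theorems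

/-- **The crux `HelicalEndLiouville` of route `SymmetryModuliCount`
(stmt-NavierStokesRegularity-14062), proved**: a Type-I ancient mild field annihilated on a
backward end `t < θ ≤ 0` by a Killing generator `(a + Ax)·∇ − A` (`A` skew, `a ∉ range A`)
vanishes on that end. Composition of the seven stubs of the line `vanishing-cell-reynolds`:
period (1) ⇒ far-past extinction of the cell oscillation (2–5) ⇒ the 2.5-D leaf kills `u` on the
far end (6) ⇒ forward vanishing up to `θ` (7). [folklore] -/
theorem symmetryModuliCount_helicalEndLiouville_proof :
    Summit.NavierStokesRegularity.NavierStokesRegularity.Theses.SymmetryModuliCount.HelicalEndLiouville := by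
  intro C u hu a A θ hA ha hθ hsym t ht x
  -- stub 1: one period `L ≠ 0` for every slice on the end
  obtain ⟨L, hL0, hper⟩ := stub_helicalScrewPeriod a A hA ha
  have hperu : ∀ τ < θ, ∀ y, u τ (y + L) = u τ y := fun τ hτ y =>
    hper (u τ) ((hu.contDiff_slice (lt_of_lt_of_le hτ hθ)).differentiable (by simp)) (hsym τ hτ) y
  -- stubs 2–5: the cell oscillation is extinct on a far end
  obtain ⟨κ, _hκ, hheat, hoseen⟩ := stub_cellGaps
  obtain ⟨K, _hK, hslice⟩ := stub_cellOscSlice κ hoseen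
  have hext := stub_cellAbsorption κ K hheat stub_cellOscRepr hslice C u hu L θ hL0 hθ hperu
  set T : ℝ := min θ (-(8 * K * C * ‖L‖) ^ 2) with hT
  have hTθ : T ≤ θ := min_le_left _ _
  have hT0 : T ≤ 0 := hTθ.trans hθ
  have hinv : ∀ τ < T, ∀ (y : EuclideanSpace ℝ (Fin 3)) (s : ℝ), u τ (y + s • L) = u τ y :=
    fun τ hτ y s => hext τ (lt_of_lt_of_le hτ hTθ) (lt_of_lt_of_le hτ (min_le_right _ _)) y s
  -- stub 6: the 2.5-D leaf on the far end; stub 7: forward vanishing up to `θ`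
  have hzero : ∀ τ < T, ∀ y, u τ y = 0 := stub_lineLiouvilleEnd C u hu L T hL0 hT0 hinv
  exact stub_forwardVanishing C u hu T hT0 hzero t (lt_of_lt_of_le ht hθ) x

end Summit.NavierStokesRegularity.NavierStokesRegularity.Theorems

end
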